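import Mathlib
import Literature.Analysis.SpecialFunctions.InvSinSqPartialFractions

/-!
# Box-lattice symbol of a momentum cutoff: `Σ_{n∈ℤ} sinc²(π(x+n)) = 1` and its tail

(Solo paper §13.8, Proposition 13.9, step (2).)  For the partition of the torus `Λ_L` into boxes
of side `R` with normalised box constants `u_B = R^{-3/2} 1_B`, the matrix
`⟨u_B, Π_{|p|>k₀} u_{B'}⟩` is translation covariant on the box lattice and its symbol at lattice
momentum `θ` is `m(θ) = Σ_{G ∈ (2π/R)ℤ³, |θ+G|>k₀} Π_i sinc²((θ_i+G_i)R/2)`.  In the normalised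
variables `x_i = θ_i R/(2π)`, `G_i R/(2π) = n_i ∈ ℤ`, the one-dimensional factor is
`sinc²(π(x_i+n_i))` (`sinc t = sin t / t`, Mathlib's `Real.sinc`).  We prove the two analytic
facts used there:

* `hasSum_sinc_sq_int` — **Parseval for the box basis**: `Σ_{n∈ℤ} sinc²(π(x+n)) = 1` for every
  real `x` (for `x ∉ ℤ` this is the Mittag-Leffler expansion `Σ_{n∈ℤ}(x+n)⁻² = π²/sin²(πx)`,
  `Literature.Analysis.SpecialFunctions.hasSum_int_inv_add_sq`, times `sin²(πx)/π²`; for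
  `x ∈ ℤ` exactly one term is `1`);
* `tsum_sinc_sq_tail_le` — **the tail bound**: for `K ≥ 1` and every real `x`,
  `Σ_{n∈ℤ, |x+n| ≥ K} sinc²(π(x+n)) ≤ 4/(π²K)` (from `sinc²(πy) ≤ 1/(π²y²)` and the telescoping
  majorant `1/y² ≤ 1/(y-½) - 1/(y+½)` along the unit-spaced points `x+n`).

The three-dimensional consequences (`Σ_{n∈ℤ³} Π_i sinc²(π(x_i+n_i)) = 1` and the symbol bound
`Σ_{n∈ℤ³, |x+n| ≥ √3·K} Π_i sinc² ≤ 12/(π²K)`, i.e. `‖PΠ_{|p|>k₀}P‖ ≤ C/(k₀R)`) are in the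
companion file `SoloBlindBoxLatticeSymbol3D`.
-/

noncomputable section

open Real Filter Finset

namespace Summit.AtomisticToContinuum.BoseEinsteinCondensation.Theorems

/-! ## Pointwise facts about `sinc²(π(x+n))` -/

/-- Off the integers, `sinc²(π(x+n)) = (sin²(πx)/π²)·(x+n)⁻²`. -/
theorem sinc_sq_pi_mul_add_int {x : ℝ} (hx : ∀ n : ℤ, x ≠ n) (n : ℤ) :
    Real.sinc (π * (x + n)) ^ 2 = Real.sin (π * x) ^ 2 / π ^ 2 * (1 / (x + n) ^ 2) := by
  have hxn : x + n ≠ 0 := by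
    intro h
    exact hx (-n) (by push_cast; linarith)
  have hπ : π * (x + n) ≠ 0 := mul_ne_zero Real.pi_ne_zero hxn
  rw [Real.sinc_of_ne_zero hπ]
  have hs : Real.sin (π * (x + n)) = (-1) ^ n * Real.sin (π * x) := by
    rw [show π * (x + n) = π * x + n * π by ring, Real.sin_add_int_mul_pi]
  have h1 : ((-1 : ℝ) ^ n) ^ 2 = 1 := by
    rw [← sq_abs, abs_zpow, abs_neg, abs_one, one_zpow, one_pow]
  rw [hs, div_pow, mul_pow, h1, one_mul, div_mul_div_comm, mul_one, mul_pow]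

/-- `sinc²(πy) ≤ 1/(π²y²)` for `y ≠ 0`. -/
theorem sinc_sq_pi_mul_le {y : ℝ} (hy : y ≠ 0) :
    Real.sinc (π * y) ^ 2 ≤ 1 / (π ^ 2 * y ^ 2) := by
  rw [Real.sinc_of_ne_zero (mul_ne_zero Real.pi_ne_zero hy), div_pow, mul_pow]
  gcongr
  exact Real.sin_sq_le_one _

/-! ## Parseval for the box basis: `Σ_{n∈ℤ} sinc²(π(x+n)) = 1` -/

/-- **`Σ_{n∈ℤ} sinc²(π(x+n)) = 1`** for every real `x`. -/
theorem hasSum_sinc_sq_int (x : ℝ) :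
    HasSum (fun n : ℤ => Real.sinc (π * (x + n)) ^ 2) 1 := by
  by_cases hx : ∀ n : ℤ, x ≠ n
  · have hsin : Real.sin (π * x) ≠ 0 := by
      rw [Ne, Real.sin_eq_zero_iff]
      rintro ⟨m, hm⟩
      have h' : π * (m : ℝ) = π * x := by rw [mul_comm]; exact hm
      exact hx m (mul_left_cancel₀ Real.pi_ne_zero h').symm
    have h := (Literature.Analysis.SpecialFunctions.hasSum_int_inv_add_sq hx).mul_left
      (Real.sin (π * x) ^ 2 / π ^ 2)
    have hπ0 : (π : ℝ) ≠ 0 := Real.pi_ne_zero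
    have hv : Real.sin (π * x) ^ 2 / π ^ 2 * (π ^ 2 / Real.sin (π * x) ^ 2) = 1 := by
      rw [div_mul_div_comm, mul_comm (π ^ 2) (Real.sin (π * x) ^ 2)]
      exact div_self (mul_ne_zero (pow_ne_zero 2 hsin) (pow_ne_zero 2 hπ0))
    rw [hv] at h
    have hfun : (fun n : ℤ => Real.sinc (π * (x + n)) ^ 2)
        = fun n : ℤ => Real.sin (π * x) ^ 2 / π ^ 2 * (1 / (x + n) ^ 2) :=
      funext (sinc_sq_pi_mul_add_int hx)
    rw [hfun]
    exact h
  · simp only [ne_eq, not_forall, not_not] at hx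
    obtain ⟨m, rfl⟩ := hx
    have h0 : ∀ n : ℤ, n ≠ -m → Real.sinc (π * ((m : ℝ) + n)) ^ 2 = 0 := by
      intro n hn
      have hne : (m : ℝ) + n ≠ 0 := by
        have : ((m + n : ℤ) : ℝ) ≠ 0 := by exact_mod_cast (show m + n ≠ 0 by omega)
        push_cast at this
        exact this
      rw [Real.sinc_of_ne_zero (mul_ne_zero Real.pi_ne_zero hne)]
      have : Real.sin (π * ((m : ℝ) + n)) = 0 := by
        rw [show π * ((m : ℝ) + n) = ((m + n : ℤ) : ℝ) * π by push_cast; ring]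
        exact Real.sin_int_mul_pi (m + n)
      rw [this, zero_div, zero_pow two_ne_zero]
    simpa using hasSum_single (f := fun n : ℤ => Real.sinc (π * ((m : ℝ) + n)) ^ 2) (-m) h0

/-- The family `sinc²(π(x+n))`, `n ∈ ℤ`, is summable with sum `1`. -/
theorem tsum_sinc_sq_int (x : ℝ) : ∑' n : ℤ, Real.sinc (π * (x + n)) ^ 2 = 1 :=
  (hasSum_sinc_sq_int x).tsum_eq

/-- Any sub-family (indicator-restricted) of `sinc²(π(x+n))` is summable. -/
theorem summable_ite_sinc_sq (x : ℝ) (p : ℤ → Prop) [DecidablePred p] :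
    Summable (fun n : ℤ => if p n then Real.sinc (π * (x + n)) ^ 2 else 0) :=
  (hasSum_sinc_sq_int x).summable.of_nonneg_of_le
    (fun n => by split_ifs <;> positivity)
    (fun n => by split_ifs <;> [exact le_rfl; positivity])

/-! ## The telescoping majorant and the one-sided tail -/

/-- `1/y² ≤ 2/(2y-1) - 2/(2y+1)` (`= 1/(y-½) - 1/(y+½)`) for `y ≥ 1`. -/
theorem one_div_sq_le_telescope {y : ℝ} (hy : 1 ≤ y) :
    1 / y ^ 2 ≤ 2 / (2 * y - 1) - 2 / (2 * y + 1) := by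
  have h1 : 2 * y - 1 ≠ 0 := by intro h; linarith
  have h2 : 2 * y + 1 ≠ 0 := by intro h; linarith
  have h3 : y ≠ 0 := by intro h; linarith
  have key : 2 / (2 * y - 1) - 2 / (2 * y + 1) - 1 / y ^ 2
      = 1 / (y ^ 2 * ((2 * y - 1) * (2 * y + 1))) := by
    field_simp
    ring
  have hpos : 0 ≤ 1 / (y ^ 2 * ((2 * y - 1) * (2 * y + 1))) := by
    have : 0 < 2 * y - 1 := by linarith
    have : 0 < 2 * y + 1 := by linarith
    positivity
  linarith [key ▸ hpos]

/-- Partial sums of the majorant: `Σ_{j<M} 1/(K+j)² ≤ 2/(2K-1) - 2/(2(K+M)-1)` for `K ≥ 1`. -/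
theorem sum_range_one_div_sq_le {K : ℝ} (hK : 1 ≤ K) (M : ℕ) :
    ∑ j ∈ Finset.range M, 1 / (K + j) ^ 2 ≤ 2 / (2 * K - 1) - 2 / (2 * (K + M) - 1) := by
  induction M with
  | zero => simp
  | succ M ih =>
    rw [Finset.sum_range_succ, Nat.cast_succ,
      show 2 * (K + ((M : ℝ) + 1)) - 1 = 2 * (K + M) + 1 by ring]
    have hM : (0 : ℝ) ≤ M := Nat.cast_nonneg M
    have h := one_div_sq_le_telescope (y := K + M) (by linarith)
    linarith

/-- A nonnegative sequence dominated by `c/(K+j)²` has sum at most `2c/K` (`K ≥ 1`). -/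
theorem tsum_le_of_le_div_sq {K c : ℝ} (hK : 1 ≤ K) (hc : 0 ≤ c) {f : ℕ → ℝ}
    (hf0 : ∀ j, 0 ≤ f j) (hf : ∀ j, f j ≤ c / (K + j) ^ 2) :
    ∑' j, f j ≤ 2 * c / K := by
  refine Real.tsum_le_of_sum_range_le hf0 fun M => ?_
  have hK0 : 0 < K := by linarith
  have hK0' : K ≠ 0 := hK0.ne'
  have hKh : 2 * K - 1 ≠ 0 := by intro h; linarith
  have step1 : ∑ j ∈ Finset.range M, f j ≤ c * (2 / (2 * K - 1) - 2 / (2 * (K + M) - 1)) :=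
    calc ∑ j ∈ Finset.range M, f j ≤ ∑ j ∈ Finset.range M, c * (1 / (K + j) ^ 2) :=
          Finset.sum_le_sum fun j _ => by rw [mul_one_div]; exact hf j
      _ = c * ∑ j ∈ Finset.range M, 1 / (K + j) ^ 2 := by rw [Finset.mul_sum]
      _ ≤ c * (2 / (2 * K - 1) - 2 / (2 * (K + M) - 1)) :=
          mul_le_mul_of_nonneg_left (sum_range_one_div_sq_le hK M) hc
  have step2 : c * (2 / (2 * K - 1) - 2 / (2 * (K + M) - 1)) ≤ c * (2 / (2 * K - 1)) := by
    apply mul_le_mul_of_nonneg_left _ hc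
    have hM : (0 : ℝ) ≤ M := Nat.cast_nonneg M
    have : 0 ≤ 2 / (2 * (K + M) - 1) := div_nonneg (by norm_num) (by linarith)
    linarith
  have step3 : c * (2 / (2 * K - 1)) ≤ 2 * c / K := by
    have e : 2 * c / K - c * (2 / (2 * K - 1)) = 2 * c * (K - 1) / (K * (2 * K - 1)) := by
      field_simp
      ring
    have : 0 ≤ 2 * c * (K - 1) / (K * (2 * K - 1)) := by
      apply div_nonneg (mul_nonneg (mul_nonneg (by norm_num) hc) (by linarith))
      exact (mul_pos hK0 (by linarith)).le
    linarith
  linarith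

/-- **Right tail**: `Σ_{n∈ℤ, x+n ≥ K} sinc²(π(x+n)) ≤ 2/(π²K)` for `K ≥ 1`. -/
theorem tsum_sinc_sq_right_tail_le {K : ℝ} (hK : 1 ≤ K) (x : ℝ) :
    ∑' n : ℤ, (if K ≤ x + n then Real.sinc (π * (x + n)) ^ 2 else 0) ≤ 2 / (π ^ 2 * K) := by
  set n₀ : ℤ := ⌈K - x⌉ with hn₀
  set F : ℤ → ℝ := fun n => if K ≤ x + n then Real.sinc (π * (x + n)) ^ 2 else 0 with hF
  have hK0 : 0 < K := by linarith
  have hxn₀ : K ≤ x + n₀ := by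
    have := Int.le_ceil (K - x)
    linarith
  have hg : Function.Injective (fun j : ℕ => n₀ + (j : ℤ)) := by
    intro a b h
    have : (a : ℤ) = b := by simpa using h
    exact_mod_cast this
  have hsupp : Function.support F ⊆ Set.range (fun j : ℕ => n₀ + (j : ℤ)) := by
    intro n hn
    rw [Function.mem_support] at hn
    have hKn : K ≤ x + n := by
      by_contra h
      exact hn (by simp [hF, h])
    have hn₀n : n₀ ≤ n := by
      rw [hn₀, Int.ceil_le]
      linarith
    refine ⟨(n - n₀).toNat, ?_⟩
    simp only
    rw [Int.toNat_of_nonneg (by linarith)]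
    ring
  have heq : ∑' n, F n = ∑' j : ℕ, F (n₀ + (j : ℤ)) := (hg.tsum_eq hsupp).symm
  rw [heq]
  have hpt : ∀ j : ℕ, F (n₀ + (j : ℤ)) ≤ (1 / π ^ 2) / (K + j) ^ 2 := by
    intro j
    have hj : (0 : ℝ) ≤ j := Nat.cast_nonneg j
    have hy : K + j ≤ x + ((n₀ + (j : ℤ) : ℤ) : ℝ) := by push_cast; linarith
    have hy0 : x + ((n₀ + (j : ℤ) : ℤ) : ℝ) ≠ 0 := by intro h; linarith
    have hcond : K ≤ x + ((n₀ + (j : ℤ) : ℤ) : ℝ) := by linarith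
    simp only [hF, if_pos hcond]
    calc Real.sinc (π * (x + ((n₀ + (j : ℤ) : ℤ) : ℝ))) ^ 2
        ≤ 1 / (π ^ 2 * (x + ((n₀ + (j : ℤ) : ℤ) : ℝ)) ^ 2) := sinc_sq_pi_mul_le hy0
      _ ≤ 1 / (π ^ 2 * (K + j) ^ 2) := by
          gcongr
      _ = (1 / π ^ 2) / (K + j) ^ 2 := by
          have hπ0 : (π : ℝ) ≠ 0 := Real.pi_ne_zero
          have : (K + j : ℝ) ≠ 0 := by intro h; linarith
          field_simp
  have h0 : ∀ j : ℕ, 0 ≤ F (n₀ + (j : ℤ)) := by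
    intro j
    simp only [hF]
    split_ifs <;> positivity
  have := tsum_le_of_le_div_sq hK (by positivity) h0 hpt
  calc ∑' j : ℕ, F (n₀ + (j : ℤ)) ≤ 2 * (1 / π ^ 2) / K := this
    _ = 2 / (π ^ 2 * K) := by
        have hπ0 : (π : ℝ) ≠ 0 := Real.pi_ne_zero
        field_simp

/-- **Left tail**: `Σ_{n∈ℤ, x+n ≤ -K} sinc²(π(x+n)) ≤ 2/(π²K)` for `K ≥ 1` (by `n ↦ -n`). -/
theorem tsum_sinc_sq_left_tail_le {K : ℝ} (hK : 1 ≤ K) (x : ℝ) :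
    ∑' n : ℤ, (if x + n ≤ -K then Real.sinc (π * (x + n)) ^ 2 else 0) ≤ 2 / (π ^ 2 * K) := by
  have h := tsum_sinc_sq_right_tail_le hK (-x)
  rw [← (Equiv.neg ℤ).tsum_eq] at h
  refine le_trans (le_of_eq (tsum_congr fun n => ?_)) h
  simp only [Equiv.neg_apply, Int.cast_neg]
  have e2 : Real.sinc (π * (-x + -(n : ℝ))) = Real.sinc (π * (x + n)) := by
    rw [show π * (-x + -(n : ℝ)) = -(π * (x + n)) by ring, Real.sinc_neg]
  rw [e2]
  by_cases hc : x + n ≤ -K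
  · rw [if_pos hc, if_pos (by linarith)]
  · rw [if_neg hc, if_neg (by intro h'; exact hc (by linarith))]

/-! ## The two-sided tail -/

/-- **Tail bound**: for `K ≥ 1` and every real `x`,
`Σ_{n∈ℤ, |x+n| ≥ K} sinc²(π(x+n)) ≤ 4/(π²K)`.  With `x = θR/(2π)`, `K = k₀R/(2π√3)` and the union
bound over the three axes this is `sup_θ m(θ) ≤ C/(k₀R)` for the box-lattice symbol of
`PΠ_{|p|>k₀}P` (paper, Prop. 13.9(2)). -/
theorem tsum_sinc_sq_tail_le {K : ℝ} (hK : 1 ≤ K) (x : ℝ) :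
    ∑' n : ℤ, (if K ≤ |x + n| then Real.sinc (π * (x + n)) ^ 2 else 0) ≤ 4 / (π ^ 2 * K) := by
  have hle : ∀ n : ℤ, (if K ≤ |x + n| then Real.sinc (π * (x + n)) ^ 2 else 0)
      ≤ (if K ≤ x + n then Real.sinc (π * (x + n)) ^ 2 else 0)
        + (if x + n ≤ -K then Real.sinc (π * (x + n)) ^ 2 else 0) := by
    intro n
    have hs0 : 0 ≤ Real.sinc (π * (x + n)) ^ 2 := sq_nonneg _
    by_cases h : K ≤ |x + n|
    · rw [if_pos h]
      rcases le_abs.1 h with h' | h'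
      · rw [if_pos h']
        have : 0 ≤ (if x + n ≤ -K then Real.sinc (π * (x + n)) ^ 2 else 0) := by
          split_ifs <;> positivity
        linarith
      · rw [if_pos (show x + n ≤ -K by linarith)]
        have : 0 ≤ (if K ≤ x + n then Real.sinc (π * (x + n)) ^ 2 else 0) := by
          split_ifs <;> positivity
        linarith
    · rw [if_neg h]
      positivity
  calc ∑' n : ℤ, (if K ≤ |x + n| then Real.sinc (π * (x + n)) ^ 2 else 0)
      ≤ ∑' n : ℤ, ((if K ≤ x + n then Real.sinc (π * (x + n)) ^ 2 else 0)
          + (if x + n ≤ -K then Real.sinc (π * (x + n)) ^ 2 else 0)) :=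
        Summable.tsum_le_tsum hle (summable_ite_sinc_sq x _)
          ((summable_ite_sinc_sq x _).add (summable_ite_sinc_sq x _))
    _ = ∑' n : ℤ, (if K ≤ x + n then Real.sinc (π * (x + n)) ^ 2 else 0)
          + ∑' n : ℤ, (if x + n ≤ -K then Real.sinc (π * (x + n)) ^ 2 else 0) :=
        (summable_ite_sinc_sq x _).tsum_add (summable_ite_sinc_sq x _)
    _ ≤ 2 / (π ^ 2 * K) + 2 / (π ^ 2 * K) :=
        add_le_add (tsum_sinc_sq_right_tail_le hK x) (tsum_sinc_sq_left_tail_le hK x)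
    _ = 4 / (π ^ 2 * K) := by ring

/-- The complementary statement used in the paper: the symbol mass inside the window,
`Σ_{n∈ℤ, |x+n| < K} sinc²(π(x+n)) ≥ 1 - 4/(π²K)`. -/
theorem one_sub_le_tsum_sinc_sq_window {K : ℝ} (hK : 1 ≤ K) (x : ℝ) :
    1 - 4 / (π ^ 2 * K)
      ≤ ∑' n : ℤ, (if |x + n| < K then Real.sinc (π * (x + n)) ^ 2 else 0) := by
  have hsplit : ∑' n : ℤ, (if |x + n| < K then Real.sinc (π * (x + n)) ^ 2 else 0)
      + ∑' n : ℤ, (if K ≤ |x + n| then Real.sinc (π * (x + n)) ^ 2 else 0) = 1 := by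
    rw [← (summable_ite_sinc_sq x (fun n : ℤ => |x + n| < K)).tsum_add
      (summable_ite_sinc_sq x (fun n : ℤ => K ≤ |x + n|)), ← tsum_sinc_sq_int x]
    refine tsum_congr fun n => ?_
    by_cases h : |x + n| < K
    · rw [if_pos h, if_neg (not_le.2 h), add_zero]
    · rw [if_neg h, if_pos (not_lt.1 h), zero_add]
  have := tsum_sinc_sq_tail_le hK x
  linarith

end Summit.AtomisticToContinuum.BoseEinsteinCondensation.Theorems
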